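import Literature.NumberTheory.QuadraticFields.BinaryQuadraticFormsClassNumber
import HarnessLib

/-!
# Class numbers of imaginary quadratic discriminants on the bed's `L2` champion lists, part (d): `D = −217627, −253507`

Topic `NumberTheory/QuadraticFields`, namespace `Literature.NumberTheory.QuadraticFields.Quadratic`; pure VALUES file (theorems only):
the form class number `BinQF.classNumber D = h(D)` of `BinaryQuadraticFormsClassNumber.lean` (the number of reduced primitive positive
definite forms of discriminant `D`, Cox Thm. 2.13, computable) evaluated by `decide +kernel` at NEGATIVE fundamental discriminants of the
landau-siegel rescue bed's rule-`L2` champion tables (the 15 least `L(1, χ_D)` and the 15 least `L(1, χ_D)·log log |D|` over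
`200 < |D| ≤ 3·10⁵`, bed-1 spec `bed1-KG1-v0.1`, engines A ≡ B; the heads `−427`, `−222643` are in
`Zhang2022/RepairBedClassNumberFormula.lean`). The files are split (a)–(f) only to bound each file's kernel time (≈ 60 s per 10⁵ of |D|).

| `D` | factorisation | `h(D)` | bed list |
|---|---|---|---|
| `−217627` | `283·769` | `36` | by L(1) #10 |
| `−253507` | `253507` | `39` | by L(1) #12 |

First consumer: `Zhang2022/RepairBedClassNumberFormulaNegL2.lean` (`L(1, χ_D) = πh/√|D|`).

## References

* [Cox2013] D. A. Cox, *Primes of the form x² + ny²*, 2nd ed. (2013), §2.A Thm. 2.8, Thm. 2.13 and (2.14).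
* [Shanks1973LittlewoodBounds] D. Shanks, Proc. Sympos. Pure Math. 24 (1973) 267–283, §1 (tables of extreme `L(1, χ_d)`).
-/

namespace Literature.NumberTheory.QuadraticFields.Quadratic

/-- **`h(−217627) = 36`** (`−217627` = −283·769; bed list by L(1) #10; kernel count of the reduced forms). [cite: Cox2013, Thm. 2.13] -/
theorem binQFClassNumber_neg217627 : BinQF.classNumber (-217627) = 36 := by
  decide +kernel

/-- **`h(−253507) = 39`** (`−253507` prime; bed list by L(1) #12; kernel count of the reduced forms). [cite: Cox2013, Thm. 2.13] -/
theorem binQFClassNumber_neg253507 : BinQF.classNumber (-253507) = 39 := by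
  decide +kernel

end Literature.NumberTheory.QuadraticFields.Quadratic
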